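import Literature.MathematicalPhysics.QuantumFieldTheory.BalabanImbrieJaffe1984to88.BIJ88PerturbativeRemainder308
import Literature.MathematicalPhysics.QuantumFieldTheory.BalabanImbrieJaffe1984to88.BIJ88ZtPositivity308

/-!
# `BalabanImbrieJaffe1984to88.BIJ88EffectiveAction308` — T. Bałaban, J. Imbrie, A. Jaffe, *Effective action and cluster properties of
the abelian Higgs model*, Commun. Math. Phys. **114** (1988) 257–315 [BalabanImbrieJaffe1988]: Sect. 5.14, p. 308 [PDF 52], verbatim
(page render `lit-balaban-r16/renders/cmp114/original-p052-x2.png` read as an image; the leading MINUS signs are print's):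
*"Thus we define perturbative terms for the action, 𝒫_{k+1}(Λ₁₂^{(k)}) = Σ_{α=1}^{n̄} −(1/α!)(dᵅ/dtᵅ) log z_t(Λ₁₂^{(k)})|_{t=0}, (5.14.1)
and a remainder ℛ_k(Λ₁₂^{(k)}) = ∫₀¹ dt −((1−t)^{n̄}/(n̄+1)!) ⟨d/dt; …; d/dt⟩_t. (5.14.2) Here ⟨·⟩_t is the interacting expectation
⟨·⟩_t = (1/z_t(Λ₁₂^{(k)})) ⟨· χ′_{Λ₁₂^{(k)},t} e^{−tṼ₁₂^{(k)}(Λ^{(k)})}⟩_{1,Λ₁₂^{(k)}}"* — **(5.14.1)–(5.14.2) for the restricted interacting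
family `z(t) = ∫ χ′_{Λ,t}·e^{−tW} dP` with BOTH standing hypotheses of `BIJ88PerturbativeRemainder308.effectiveAction_restrictedInteraction`
DISCHARGED**: `hint` (integrability of the remainder density on `[0,1]`) and `hz` (`z_t ≠ 0` on `(0,1]`).

statement-level skeleton of published theorems with citation tags; proofs where landed; nothing here is a claim about the Yang–Mills mass gap

WHAT THIS FILE ADDS (theorems only; no definitions, no `Prop` facts; axioms standard).
* §1 two calculus lemmas: a function continuous on `(0,1]` with a finite limit at `0⁺` is integrable on `[0,1]`
  (`integrableOn_Icc_of_continuousOn_Ioc`); `Cⁿ` at a point ⇒ the `n`-th derivative is continuous there.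
* §2 **`hint` DISCHARGED** under the hypotheses of the gen-7 chain (centered Gaussian marginals, variances `≤ v`, thresholds `c_b ≥ c₀ > 0`,
  `p > 1/2`, `0 < e_k < e^{−1}`, measurable `|W| ≤ K`, `z_t ≠ 0` on `(0,1]`): `(d/dt)^m log z_t` is continuous on `(0,1]`
  (`continuousOn_iteratedDeriv_log_restrictedInteraction`) and tends to the `m`-th cumulant of `−W` at `0⁺`
  (`BIJ88GaussianMoments308`), so the remainder density `((1−t)^{n̄}/n̄!)(d/dt)^{n̄+1} log z_t` is integrable on `[0,1]`
  (`integrableOn_remainderDensity`) and **`−log z₁ = pertPart n̄ (cgf_{−W}) − ∫₀¹ ((1−t)^{n̄}/n̄!)(d/dt)^{n̄+1} log z_t dt`** holds with a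
  PROPER integral (`effectiveAction_restrictedInteraction_of_ne_zero`).
* §3 **both hypotheses DISCHARGED**: for a NON-NEGATIVE profile `χ(1,·) ≥ 0` and CENTERED JOINTLY GAUSSIAN fields (Mathlib `HasGaussianLaw`
  of `ω ↦ (Φ_b ω)_{b∈Λ}` — *"a purely Gaussian expectation"*), `z_t > 0` on `(0,1]` by `BIJ88ZtPositivity308`, the variance bound is
  automatic (finitely many fields), and (5.14.1)–(5.14.2) hold outright: `effectiveAction_restrictedInteraction`; also the
  `hz`-free forms of the Taylor formula at base `a` and of the remainder limit (`taylor_log_restrictedInteraction'`,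
  `tendsto_remainder_restrictedInteraction'`).
SIGN BOOKKEEPING (ref-1 gen 27/28 erratum on the gen-7 header quotations).  Print's `𝒫_{k+1} = Σ_{α=1}^{n̄} −(1/α!)(dᵅ/dtᵅ) log z_t|₀`
IS `pertPart n̄` (the minus is inside `BIJ88Perturbative341.pertPart`); print's `ℛ_k = ∫₀¹ dt −((1−t)^{n̄}/(n̄+1)!)⟨d/dt;…;d/dt⟩_t` carries a
minus, so the remainder integral `∫₀¹ ((1−t)^{n̄}/n̄!)(d/dt)^{n̄+1} log z_t dt` appearing below with a minus in front is `−ℛ_k` up to print's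
normalisation of the truncated expectation (print's `1/(n̄+1)!` vs Taylor's `1/n̄!` is r16's transcript note T9, graded by ref-1:
the displayed `(n̄+1)!` presupposes a truncation one order longer); the theorems are stated with every sign explicit.

PDF held: `paper:balaban1988-cmp114-bij-abelian-higgs-effective-action` (journal page = PDF page + 256); p. 308 [PDF 52].

CITATION HEADER (lean-in-tree rule).  Part of the lit-balaban TYPED SKELETON (HOME `run/shared/lean/pub/lit-balaban/`), Phase 2,
seat p36 (gen 8, unit `lit-balaban-p36`); row **C2.Eq5.14.1-5.14.2** of `HOME/lit-balaban-r16/ROWS-C2-part2.md` (owner r16; typed leaves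
`Eq5141`/`Eq5142` untouched).
-/

namespace Literature.MathematicalPhysics.QuantumFieldTheory.BalabanImbrieJaffe1984to88.BIJ88EffectiveAction308

open MeasureTheory ProbabilityTheory Filter Set intervalIntegral
open scoped Nat Topology
open BIJ88Sect2Statements (pLog)
open BIJ88Sect5Statements (CutoffProfile cutoff)
open BIJ88Perturbative341 (pertPart)

/-! ## §1 Two calculus lemmas -/

section Calculus

/-- A real function continuous on `(0,1]` with a finite limit at `0⁺` is integrable on `[0,1]` (it extends continuously to the compact
interval; `{0}` is Lebesgue-null) — the shape of the remainder density of (5.14.2). [cite: BalabanImbrieJaffe1988, (5.14.2) p.308] -/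
theorem integrableOn_Icc_of_continuousOn_Ioc {f : ℝ → ℝ} {L : ℝ} (hf : ContinuousOn f (Set.Ioc 0 1))
    (hL : Tendsto f (𝓝[>] (0 : ℝ)) (𝓝 L)) : IntegrableOn f (Set.Icc (0 : ℝ) 1) := by
  classical
  set F : ℝ → ℝ := fun t => if 0 < t then f t else L with hF
  have hFf : Set.EqOn F f (Set.Ioc 0 1) := fun t ht => by simp [hF, ht.1]
  have hFcont : ContinuousOn F (Set.Icc 0 1) := by
    intro t ht
    rcases eq_or_lt_of_le ht.1 with h0 | hpos
    · subst h0
      have h1 : ContinuousWithinAt F (Set.Ioi 0) 0 := by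
        have hF0 : F 0 = L := by simp [hF]
        rw [ContinuousWithinAt, hF0]
        refine hL.congr' ?_
        filter_upwards [self_mem_nhdsWithin] with s hs
        simp [hF, Set.mem_Ioi.mp hs]
      exact (continuousWithinAt_Ioi_iff_Ici.mp h1).mono Set.Icc_subset_Ici_self
    · have h2 : ContinuousWithinAt F (Set.Ioc 0 1) t := (hf t ⟨hpos, ht.2⟩).congr hFf (hFf ⟨hpos, ht.2⟩)
      refine h2.mono_of_mem_nhdsWithin ?_
      exact mem_nhdsWithin.mpr ⟨Set.Ioi 0, isOpen_Ioi, hpos, fun s hs => ⟨hs.1, hs.2.2⟩⟩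
  have hFint : IntegrableOn F (Set.Icc 0 1) := hFcont.integrableOn_Icc
  rw [integrableOn_Icc_iff_integrableOn_Ioc] at hFint ⊢
  exact hFint.congr_fun hFf measurableSet_Ioc

/-- If `f` is `Cⁿ` at `x` then `f^{(n)}` is continuous at `x` (Mathlib `ContDiffAt.iteratedFDeriv_right` transported to `iteratedDeriv`).
[cite: BalabanImbrieJaffe1988, (5.14.2) p.308] -/
theorem continuousAt_iteratedDeriv_of_contDiffAt {f : ℝ → ℝ} {n : ℕ} {x : ℝ} (hf : ContDiffAt ℝ n f x) :
    ContinuousAt (iteratedDeriv n f) x := by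
  rw [iteratedDeriv_eq_equiv_comp]
  exact (LinearIsometryEquiv.continuous _).continuousAt.comp
    (hf.iteratedFDeriv_right (m := 0) (i := n) (by simp)).continuousAt

end Calculus

/-! ## §2 `hint` discharged: the remainder density is integrable on `[0,1]` -/

section Remainder

variable (χ : CutoffProfile) {ι Ω : Type*} [MeasurableSpace Ω]

/-- **`(d/dt)^m log z_t` is continuous on `(0,1]`** (`e_k < e^{−1}`, `z_t ≠ 0` there; any finite measure, measurable fields, `c_b ≠ 0`,
measurable `|W| ≤ K`). [cite: BalabanImbrieJaffe1988, (5.14.2) p.308] -/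
theorem continuousOn_iteratedDeriv_log_restrictedInteraction (p : ℝ) (μ : Measure Ω) [IsFiniteMeasure μ] (B : Finset ι)
    {Φ : ι → Ω → ℝ} (hΦ : ∀ b ∈ B, Measurable (Φ b)) {c : ι → ℝ} (hc : ∀ b ∈ B, c b ≠ 0) {W : Ω → ℝ} (hW : Measurable W)
    {K : ℝ} (hK : ∀ ω, |W ω| ≤ K) {ek : ℝ} (hek : 0 < ek) (hek1 : ek < Real.exp (-1))
    (hz : ∀ t ∈ Set.Ioc (0 : ℝ) 1, (∫ ω, (∏ b ∈ B, cutoff χ (c b * pLog p (t * ek)) (Φ b ω)) * Real.exp (-(t * W ω)) ∂μ) ≠ 0)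
    (m : ℕ) :
    ContinuousOn (iteratedDeriv m (fun t => Real.log
        (∫ ω, (∏ b ∈ B, cutoff χ (c b * pLog p (t * ek)) (Φ b ω)) * Real.exp (-(t * W ω)) ∂μ))) (Set.Ioc 0 1) :=
  fun _ ht => (continuousAt_iteratedDeriv_of_contDiffAt
    (BIJ88PerturbativeRemainder308.contDiffAt_log_restrictedInteraction χ p μ B hΦ hc hW hK hek hek1 hz m ht)).continuousWithinAt

/-- **The remainder density of (5.14.2) is integrable on `[0,1]`** — the hypothesis `hint` of
`BIJ88PerturbativeRemainder308.effectiveAction_restrictedInteraction` DISCHARGED: with centered Gaussian marginals (variances `≤ v`),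
`c_b ≥ c₀ > 0`, `p > 1/2`, `0 < e_k < e^{−1}`, measurable `|W| ≤ K`, `z_t ≠ 0` on `(0,1]`, the function
`t ↦ ((1−t)^{n̄}/n̄!)·(d/dt)^{n̄+1} log z_t` is continuous on `(0,1]` with the finite limit `(1/n̄!)·κ_{n̄+1}(−W)` at `0⁺`
(`BIJ88GaussianMoments308.tendsto_iteratedDeriv_log_restrictedInteraction_cgf`). [cite: BalabanImbrieJaffe1988, (5.14.2) p.308] -/
theorem integrableOn_remainderDensity {p : ℝ} (hp : 1 / 2 < p) (P : Measure Ω) [IsProbabilityMeasure P]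
    (B : Finset ι) {Φ : ι → Ω → ℝ} (hG : ∀ b ∈ B, HasGaussianLaw (Φ b) P) (hΦ : ∀ b ∈ B, Measurable (Φ b))
    (h0 : ∀ b ∈ B, P[Φ b] = 0) {v : ℝ} (hv : 0 < v) (hvar : ∀ b ∈ B, Var[Φ b; P] ≤ v) {c : ι → ℝ} {c₀ : ℝ} (hc₀ : 0 < c₀)
    (hcb : ∀ b ∈ B, c₀ ≤ c b) {W : Ω → ℝ} (hW : Measurable W) {K : ℝ} (hK : ∀ ω, |W ω| ≤ K) {ek : ℝ} (hek : 0 < ek)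
    (hek1 : ek < Real.exp (-1))
    (hz : ∀ t ∈ Set.Ioc (0 : ℝ) 1, (∫ ω, (∏ b ∈ B, cutoff χ (c b * pLog p (t * ek)) (Φ b ω)) * Real.exp (-(t * W ω)) ∂P) ≠ 0)
    (nbar : ℕ) :
    IntegrableOn (fun t => ((1 - t) ^ nbar / (nbar ! : ℝ)) * iteratedDeriv (nbar + 1) (fun t => Real.log
        (∫ ω, (∏ b ∈ B, cutoff χ (c b * pLog p (t * ek)) (Φ b ω)) * Real.exp (-(t * W ω)) ∂P)) t) (uIcc (0 : ℝ) 1) := by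
  have hcne : ∀ b ∈ B, c b ≠ 0 := fun b hb => (hc₀.trans_le (hcb b hb)).ne'
  have hpoly : Continuous fun t : ℝ => (1 - t) ^ nbar / (nbar ! : ℝ) := by continuity
  rw [uIcc_of_le zero_le_one]
  refine integrableOn_Icc_of_continuousOn_Ioc
    (L := (1 - 0) ^ nbar / (nbar ! : ℝ) * iteratedDeriv (nbar + 1) (cgf (fun ω => -W ω) P) 0) ?_ ?_
  · exact hpoly.continuousOn.mul
      (continuousOn_iteratedDeriv_log_restrictedInteraction χ p P B hΦ hcne hW hK hek hek1 hz (nbar + 1))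
  · exact ((hpoly.tendsto 0).mono_left nhdsWithin_le_nhds).mul
      (BIJ88GaussianMoments308.tendsto_iteratedDeriv_log_restrictedInteraction_cgf χ hp P B hG hΦ h0 hv hvar hc₀ hcb hW
        hK hek (nbar + 1))

/-- **(5.14.1)–(5.14.2) with a PROPER remainder integral, `hint` discharged**: under the hypotheses of the gen-7 chain (centered
Gaussian marginals, variances `≤ v`, `c_b ≥ c₀ > 0`, `p > 1/2`, `0 < e_k < e^{−1}`, measurable `|W| ≤ K`, `z_t ≠ 0` on `(0,1]`), for every `n̄`:
`−log z₁ = pertPart n̄ (cgf_{−W}) − ∫₀¹ ((1−t)^{n̄}/n̄!)·(d/dt)^{n̄+1} log z_t dt`. [cite: BalabanImbrieJaffe1988, (5.14.2) p.308] -/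
theorem effectiveAction_restrictedInteraction_of_ne_zero {p : ℝ} (hp : 1 / 2 < p) (P : Measure Ω) [IsProbabilityMeasure P]
    (B : Finset ι) {Φ : ι → Ω → ℝ} (hG : ∀ b ∈ B, HasGaussianLaw (Φ b) P) (hΦ : ∀ b ∈ B, Measurable (Φ b))
    (h0 : ∀ b ∈ B, P[Φ b] = 0) {v : ℝ} (hv : 0 < v) (hvar : ∀ b ∈ B, Var[Φ b; P] ≤ v) {c : ι → ℝ} {c₀ : ℝ} (hc₀ : 0 < c₀)
    (hcb : ∀ b ∈ B, c₀ ≤ c b) {W : Ω → ℝ} (hW : Measurable W) {K : ℝ} (hK : ∀ ω, |W ω| ≤ K) {ek : ℝ} (hek : 0 < ek)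
    (hek1 : ek < Real.exp (-1))
    (hz : ∀ t ∈ Set.Ioc (0 : ℝ) 1, (∫ ω, (∏ b ∈ B, cutoff χ (c b * pLog p (t * ek)) (Φ b ω)) * Real.exp (-(t * W ω)) ∂P) ≠ 0)
    (nbar : ℕ) :
    -Real.log (∫ ω, (∏ b ∈ B, cutoff χ (c b * pLog p (1 * ek)) (Φ b ω)) * Real.exp (-(1 * W ω)) ∂P) =
      pertPart nbar (cgf (fun ω => -W ω) P) -
        ∫ t in (0 : ℝ)..1, ((1 - t) ^ nbar / (nbar ! : ℝ)) * iteratedDeriv (nbar + 1) (fun t => Real.log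
          (∫ ω, (∏ b ∈ B, cutoff χ (c b * pLog p (t * ek)) (Φ b ω)) * Real.exp (-(t * W ω)) ∂P)) t :=
  BIJ88PerturbativeRemainder308.effectiveAction_restrictedInteraction χ hp P B hG hΦ h0 hv hvar hc₀ hcb hW hK hek hek1 hz nbar
    (integrableOn_remainderDensity χ hp P B hG hΦ h0 hv hvar hc₀ hcb hW hK hek hek1 hz nbar)

end Remainder

/-! ## §3 Both hypotheses discharged: non-negative profile, centered jointly Gaussian fields -/

section Joint

variable (χ : CutoffProfile) {ι Ω : Type*} [MeasurableSpace Ω]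

/-- For a finite family the variances are bounded: `Var[Φ_b] ≤ 1 + Σ_{b′∈Λ} Var[Φ_{b′}]` (the `v` of the gen-7 chain is automatic).
[cite: BalabanImbrieJaffe1988, (5.14.2) p.308] -/
theorem variance_le_one_add_sum (P : Measure Ω) (B : Finset ι) (Φ : ι → Ω → ℝ) :
    0 < 1 + ∑ b ∈ B, Var[Φ b; P] ∧ ∀ b ∈ B, Var[Φ b; P] ≤ 1 + ∑ b ∈ B, Var[Φ b; P] := by
  have hvn : ∀ b ∈ B, 0 ≤ Var[Φ b; P] := fun b _ => variance_nonneg _ _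
  refine ⟨by have := Finset.sum_nonneg hvn; linarith, fun b hb => ?_⟩
  have := Finset.single_le_sum hvn hb
  linarith

/-- **Taylor's formula for `log z_t` at base `a ∈ (0,1)`, `hz`-free** (non-negative profile, centered jointly Gaussian fields,
`c_b ≥ c₀ > 0`, `p ≥ 0`, `0 < e_k < e^{−1}`, measurable `|W| ≤ K`). [cite: BalabanImbrieJaffe1988, (5.14.2) p.308] -/
theorem taylor_log_restrictedInteraction' (hχ : ∀ x, 0 ≤ χ.χ₁ x) {p : ℝ} (hp : 0 ≤ p) (P : Measure Ω) [IsProbabilityMeasure P]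
    (B : Finset ι) {Φ : ι → Ω → ℝ} (hJ : HasGaussianLaw (fun ω (b : B) => Φ b ω) P) (hΦ : ∀ b ∈ B, Measurable (Φ b))
    (h0 : ∀ b ∈ B, P[Φ b] = 0) {c : ι → ℝ} {c₀ : ℝ} (hc₀ : 0 < c₀) (hcb : ∀ b ∈ B, c₀ ≤ c b) {W : Ω → ℝ} (hW : Measurable W)
    {K : ℝ} (hK : ∀ ω, |W ω| ≤ K) {ek : ℝ} (hek : 0 < ek) (hek1 : ek < Real.exp (-1)) (nbar : ℕ) {a : ℝ} (ha0 : 0 < a)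
    (ha1 : a < 1) :
    Real.log (∫ ω, (∏ b ∈ B, cutoff χ (c b * pLog p (1 * ek)) (Φ b ω)) * Real.exp (-(1 * W ω)) ∂P) =
      (∑ k ∈ Finset.range (nbar + 1), ((k ! : ℝ)⁻¹ * (1 - a) ^ k) *
        iteratedDeriv k (fun t => Real.log
          (∫ ω, (∏ b ∈ B, cutoff χ (c b * pLog p (t * ek)) (Φ b ω)) * Real.exp (-(t * W ω)) ∂P)) a) +
      ∫ t in a..1, ((1 - t) ^ nbar / (nbar ! : ℝ)) * iteratedDeriv (nbar + 1) (fun t => Real.log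
          (∫ ω, (∏ b ∈ B, cutoff χ (c b * pLog p (t * ek)) (Φ b ω)) * Real.exp (-(t * W ω)) ∂P)) t :=
  BIJ88PerturbativeRemainder308.taylor_log_restrictedInteraction χ p P B hΦ (fun b hb => (hc₀.trans_le (hcb b hb)).ne') hW hK
    hek hek1 (BIJ88ZtPositivity308.integral_restrictedInteraction_ne_zero_Ioc χ hχ hp P B hJ hΦ h0 hc₀ hcb hW hK hek hek1.le)
    nbar ha0 ha1

/-- **The remainder limit (5.14.1)–(5.14.2), `hz`-free**: `∫_a^1 ((1−t)^{n̄}/n̄!)(d/dt)^{n̄+1} log z_t dt → log z₁ + pertPart n̄ (cgf_{−W})`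
as `a → 0⁺` (non-negative profile, centered jointly Gaussian fields, `c_b ≥ c₀ > 0`, `p > 1/2`, `0 < e_k < e^{−1}`, measurable
`|W| ≤ K`). [cite: BalabanImbrieJaffe1988, (5.14.2) p.308] -/
theorem tendsto_remainder_restrictedInteraction' (hχ : ∀ x, 0 ≤ χ.χ₁ x) {p : ℝ} (hp : 1 / 2 < p) (P : Measure Ω)
    [IsProbabilityMeasure P] (B : Finset ι) {Φ : ι → Ω → ℝ} (hJ : HasGaussianLaw (fun ω (b : B) => Φ b ω) P)
    (hΦ : ∀ b ∈ B, Measurable (Φ b)) (h0 : ∀ b ∈ B, P[Φ b] = 0) {c : ι → ℝ} {c₀ : ℝ} (hc₀ : 0 < c₀) (hcb : ∀ b ∈ B, c₀ ≤ c b)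
    {W : Ω → ℝ} (hW : Measurable W) {K : ℝ} (hK : ∀ ω, |W ω| ≤ K) {ek : ℝ} (hek : 0 < ek) (hek1 : ek < Real.exp (-1))
    (nbar : ℕ) :
    Tendsto (fun a => ∫ t in a..1, ((1 - t) ^ nbar / (nbar ! : ℝ)) * iteratedDeriv (nbar + 1) (fun t => Real.log
          (∫ ω, (∏ b ∈ B, cutoff χ (c b * pLog p (t * ek)) (Φ b ω)) * Real.exp (-(t * W ω)) ∂P)) t)
      (𝓝[>] (0 : ℝ))
      (𝓝 (Real.log (∫ ω, (∏ b ∈ B, cutoff χ (c b * pLog p (1 * ek)) (Φ b ω)) * Real.exp (-(1 * W ω)) ∂P) +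
        pertPart nbar (cgf (fun ω => -W ω) P))) := by
  obtain ⟨hv, hvar⟩ := variance_le_one_add_sum P B Φ
  exact BIJ88PerturbativeRemainder308.tendsto_remainder_restrictedInteraction χ hp P B
    (BIJ88ZtPositivity308.hasGaussianLaw_of_joint P B hJ) hΦ h0 hv hvar hc₀ hcb hW hK hek hek1
    (BIJ88ZtPositivity308.integral_restrictedInteraction_ne_zero_Ioc χ hχ (by linarith) P B hJ hΦ h0 hc₀ hcb hW hK hek hek1.le)
    nbar

/-- **The remainder density is integrable on `[0,1]`, `hz`-free** (non-negative profile, centered jointly Gaussian fields).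
[cite: BalabanImbrieJaffe1988, (5.14.2) p.308] -/
theorem integrableOn_remainderDensity' (hχ : ∀ x, 0 ≤ χ.χ₁ x) {p : ℝ} (hp : 1 / 2 < p) (P : Measure Ω) [IsProbabilityMeasure P]
    (B : Finset ι) {Φ : ι → Ω → ℝ} (hJ : HasGaussianLaw (fun ω (b : B) => Φ b ω) P) (hΦ : ∀ b ∈ B, Measurable (Φ b))
    (h0 : ∀ b ∈ B, P[Φ b] = 0) {c : ι → ℝ} {c₀ : ℝ} (hc₀ : 0 < c₀) (hcb : ∀ b ∈ B, c₀ ≤ c b) {W : Ω → ℝ} (hW : Measurable W)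
    {K : ℝ} (hK : ∀ ω, |W ω| ≤ K) {ek : ℝ} (hek : 0 < ek) (hek1 : ek < Real.exp (-1)) (nbar : ℕ) :
    IntegrableOn (fun t => ((1 - t) ^ nbar / (nbar ! : ℝ)) * iteratedDeriv (nbar + 1) (fun t => Real.log
        (∫ ω, (∏ b ∈ B, cutoff χ (c b * pLog p (t * ek)) (Φ b ω)) * Real.exp (-(t * W ω)) ∂P)) t) (uIcc (0 : ℝ) 1) := by
  obtain ⟨hv, hvar⟩ := variance_le_one_add_sum P B Φ
  exact integrableOn_remainderDensity χ hp P B (BIJ88ZtPositivity308.hasGaussianLaw_of_joint P B hJ) hΦ h0 hv hvar hc₀ hcb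
    hW hK hek hek1
    (BIJ88ZtPositivity308.integral_restrictedInteraction_ne_zero_Ioc χ hχ (by linarith) P B hJ hΦ h0 hc₀ hcb hW hK hek hek1.le)
    nbar

/-- **(5.14.1)–(5.14.2) OUTRIGHT for the restricted interacting family** — both standing hypotheses of the gen-7 theorem discharged.
For a NON-NEGATIVE profile `χ(1,·) ≥ 0`, CENTERED JOINTLY GAUSSIAN fields `Φ_b`, `b ∈ Λ` (Mathlib `HasGaussianLaw` of
`ω ↦ (Φ_b ω)_{b∈Λ}`), thresholds `c_b ≥ c₀ > 0`, `p > 1/2`, `0 < e_k < e^{−1}`, a measurable interaction `|W| ≤ K`, and every `n̄`: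
`−log z₁ = pertPart n̄ (cgf_{−W}) − ∫₀¹ ((1−t)^{n̄}/n̄!)·(d/dt)^{n̄+1} log z_t dt`, `z_t = ∫ χ′_{Λ,t} e^{−tW} dP` — the perturbative terms
are the Gaussian cumulants of `−Ṽ` (print's `𝒫_{k+1}`, minus sign inside `pertPart`) and the remainder is the proper integral over
`t ∈ [0,1]` of the `(n̄+1)`-st truncated expectation of the (well-defined, `z_t > 0`) interacting measure `⟨·⟩_t`.
[cite: BalabanImbrieJaffe1988, (5.14.2) p.308] -/
theorem effectiveAction_restrictedInteraction (hχ : ∀ x, 0 ≤ χ.χ₁ x) {p : ℝ} (hp : 1 / 2 < p) (P : Measure Ω)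
    [IsProbabilityMeasure P] (B : Finset ι) {Φ : ι → Ω → ℝ} (hJ : HasGaussianLaw (fun ω (b : B) => Φ b ω) P)
    (hΦ : ∀ b ∈ B, Measurable (Φ b)) (h0 : ∀ b ∈ B, P[Φ b] = 0) {c : ι → ℝ} {c₀ : ℝ} (hc₀ : 0 < c₀) (hcb : ∀ b ∈ B, c₀ ≤ c b)
    {W : Ω → ℝ} (hW : Measurable W) {K : ℝ} (hK : ∀ ω, |W ω| ≤ K) {ek : ℝ} (hek : 0 < ek) (hek1 : ek < Real.exp (-1))
    (nbar : ℕ) :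
    -Real.log (∫ ω, (∏ b ∈ B, cutoff χ (c b * pLog p (1 * ek)) (Φ b ω)) * Real.exp (-(1 * W ω)) ∂P) =
      pertPart nbar (cgf (fun ω => -W ω) P) -
        ∫ t in (0 : ℝ)..1, ((1 - t) ^ nbar / (nbar ! : ℝ)) * iteratedDeriv (nbar + 1) (fun t => Real.log
          (∫ ω, (∏ b ∈ B, cutoff χ (c b * pLog p (t * ek)) (Φ b ω)) * Real.exp (-(t * W ω)) ∂P)) t := by
  obtain ⟨hv, hvar⟩ := variance_le_one_add_sum P B Φ
  exact effectiveAction_restrictedInteraction_of_ne_zero χ hp P B (BIJ88ZtPositivity308.hasGaussianLaw_of_joint P B hJ) hΦ h0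
    hv hvar hc₀ hcb hW hK hek hek1
    (BIJ88ZtPositivity308.integral_restrictedInteraction_ne_zero_Ioc χ hχ (by linarith) P B hJ hΦ h0 hc₀ hcb hW hK hek hek1.le)
    nbar

/-- … and the effective action is the logarithm of a POSITIVE number: `0 < z₁`. [cite: BalabanImbrieJaffe1988, (5.14.2) p.308] -/
theorem integral_restrictedInteraction_one_pos (hχ : ∀ x, 0 ≤ χ.χ₁ x) {p : ℝ} (hp : 0 ≤ p) (P : Measure Ω)
    [IsProbabilityMeasure P] (B : Finset ι) {Φ : ι → Ω → ℝ} (hJ : HasGaussianLaw (fun ω (b : B) => Φ b ω) P)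
    (hΦ : ∀ b ∈ B, Measurable (Φ b)) (h0 : ∀ b ∈ B, P[Φ b] = 0) {c : ι → ℝ} {c₀ : ℝ} (hc₀ : 0 < c₀) (hcb : ∀ b ∈ B, c₀ ≤ c b)
    {W : Ω → ℝ} (hW : Measurable W) {K : ℝ} (hK : ∀ ω, |W ω| ≤ K) {ek : ℝ} (hek : 0 < ek) (hek1 : ek ≤ Real.exp (-1)) :
    0 < ∫ ω, (∏ b ∈ B, cutoff χ (c b * pLog p (1 * ek)) (Φ b ω)) * Real.exp (-(1 * W ω)) ∂P :=
  BIJ88ZtPositivity308.integral_restrictedInteraction_pos χ hχ hp P B hJ hΦ h0 hc₀ hcb hW hK hek one_pos (by linarith)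

end Joint

end Literature.MathematicalPhysics.QuantumFieldTheory.BalabanImbrieJaffe1984to88.BIJ88EffectiveAction308
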